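import Literature.Probability.LatticeModels.TorusHeatKernel1D
import Literature.Probability.LatticeModels.LatticeGreenFunction
import Mathlib.Analysis.SpecialFunctions.Integrals.Basic
import HarnessLib

/-!
# The heat-kernel representation of the torus Green function and of its Hessian

Topic `Probability/LatticeModels`, companion of `LatticeGreenFunction.lean` (the zero-mode-removed
Green function `torusGreen z = L^{-d} ∑_{k ≠ 0} cos(p_k·z)/ε(p_k)` of the torus `(ℤ/Lℤ)^d`) and of
`TorusHeatKernel1D.lean` (the heat kernel `torusHeatKernel t m = q^L_t(m)` of the continuous-time
simple random walk on `ℤ/Lℤ`). PROVED here (all `d`, all `L ≥ 1`):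

* `prod_torusHeatKernel_eq_sum` — the heat kernel of `ε` on `(ℤ/Lℤ)^d` is the product of the
  one-dimensional ones: `∏ᵢ q^L_s(zᵢ) = L^{-d} ∑_k cos(p_k·z) e^{-sε(p_k)}` (characters factorise);
* `torusGreen_eq_integral_add_tail` — for every `S ≥ 0`,
  `torusGreen z = ∫₀^S (∏ᵢ q^L_s(zᵢ) - L^{-d}) ds + L^{-d} ∑_{k ≠ 0} cos(p_k·z) e^{-Sε(p_k)}/ε(p_k)`
  (`1/ε = ∫₀^S e^{-sε} ds + e^{-Sε}/ε` mode by mode; finite sums only);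
* `torusGreen_hessian_eq` — the mixed second difference
  `∇ᵢ⁺∇ⱼ⁻G(z) = G(z+eᵢ) - G(z+eᵢ-eⱼ) - G(z) + G(z-eⱼ)` of `torusGreen` is the time integral of the
  same difference of the product heat kernel plus the Fourier tail
  `L^{-d} ∑_{k ≠ 0} (e^{-Sε_k}/ε_k) Re[χ_k(z)(χ_k(eᵢ) - 1)(1 - conj χ_k(eⱼ))]`;
* `abs_torusGreen_hessian_tail_le` — at `S = L²` the tail is `O(L^{-d})` uniformly in `z, i, j`:
  `|χ_k(eᵢ) - 1||χ_k(eⱼ) - 1| ≤ ‖p̃_k‖²_∞ ≤ (π²/2) ε_k` cancels the small divisor `ε_k`, and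
  `e^{-L²ε_k} ≤ ∏_μ e^{-8 k̃_μ²}` is summable over the centred momenta `k̃ = valMinAbs k`.

These are the inputs of the `dist^{-4}` decay of the Hessian of the torus Green function in `d = 4`
(`TorusGreenHessianDecay.lean`), a discrete Calderón–Zygmund estimate uniform in the period `L`.

## References

* G. F. Lawler, V. Limic, *Random Walk: A Modern Introduction*, CUP 2010, Ch. 4 (Green's
  functions of random walks through the heat kernel / local central limit theorem)
  [LawlerLimic2010]; the finite-volume bookkeeping (zero mode, Fourier tail) is folklore.

## Mathlib

Finite Fourier analysis on `(ℤ/Lℤ)^d` is the tree's (`TorusFourierProofs.lean`, on Mathlib's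
`ZMod.stdAddChar`); used from Mathlib: `Finset.prod_univ_sum`, `intervalIntegral.integral_comp_mul_left`,
`integral_exp`, Jordan's inequality `Real.cos_le_one_sub_mul_cos_sq`, `ZMod.valMinAbs`.
-/

noncomputable section

open MeasureTheory Set Filter Finset ZMod intervalIntegral
open scoped Real Topology BigOperators ComplexConjugate

namespace Literature.Probability.LatticeModels

variable {d L : ℕ} [NeZero L]

/-! ### The heat kernel of `(ℤ/Lℤ)^d` is a product -/

/-- `χ_k(z) e^{-sε(p_k)} = ∏ᵢ e(kᵢzᵢ) e^{-s(1 - Re e(kᵢ))}`. [folklore] -/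
theorem torusChar_mul_exp_eq_prod (s : ℝ) (k z : TorusSite d L) :
    torusChar k z * ((Real.exp (-(s * dispersion (latticeMomentum L k))) : ℝ) : ℂ) =
      ∏ i, ((stdAddChar (k i * z i) : ℂ) *
        ((Real.exp (-(s * (1 - (stdAddChar (k i) : ℂ).re))) : ℝ) : ℂ)) := by
  rw [Finset.prod_mul_distrib, torusChar, ← Complex.ofReal_prod, ← Real.exp_sum]
  congr 3
  rw [dispersion, Finset.mul_sum, ← Finset.sum_neg_distrib]
  refine Finset.sum_congr rfl fun i _ => ?_
  rw [re_stdAddChar, latticeMomentum]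

/-- **The heat kernel of `(ℤ/Lℤ)^d` is the product of the one-dimensional heat kernels**:
`∏ᵢ q^L_s(zᵢ) = L^{-d} ∑_k cos(p_k·z) e^{-sε(p_k)}` (the sum over `k ∈ (ℤ/Lℤ)^d` of a product of
functions of the coordinates `kᵢ` is the product of the coordinate sums). [folklore] -/
theorem prod_torusHeatKernel_eq_sum (s : ℝ) (z : TorusSite d L) :
    ∏ i, torusHeatKernel s (z i) =
      (∑ k : TorusSite d L, Real.cos (∑ i, latticeMomentum L k i * ((z i).val : ℝ)) *
        Real.exp (-(s * dispersion (latticeMomentum L k)))) / (L : ℝ) ^ d := by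
  classical
  have hC : ((∏ i, torusHeatKernel s (z i) : ℝ) : ℂ) = (((L : ℝ) ^ d)⁻¹ : ℝ) *
      ∑ k : TorusSite d L, torusChar k z *
        ((Real.exp (-(s * dispersion (latticeMomentum L k))) : ℝ) : ℂ) := by
    rw [Complex.ofReal_prod]
    simp_rw [ofReal_torusHeatKernel, torusChar_mul_exp_eq_prod]
    rw [Finset.prod_div_distrib, Finset.prod_const, Finset.card_univ, Fintype.card_fin,
      div_eq_inv_mul, Finset.prod_univ_sum]
    simp only [Fintype.piFinset_univ]
    push_cast
    rfl
  apply_fun Complex.re at hC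
  rw [Complex.ofReal_re, Complex.re_ofReal_mul, Complex.re_sum] at hC
  rw [hC, div_eq_inv_mul]
  congr 1
  refine Finset.sum_congr rfl fun k _ => ?_
  rw [Complex.re_mul_ofReal, torusChar_re]

/-- The product heat kernel is continuous in time. [folklore] -/
theorem continuous_prod_torusHeatKernel (z : TorusSite d L) :
    Continuous fun s : ℝ => ∏ i, torusHeatKernel s (z i) :=
  continuous_finsetProd _ fun i _ => continuous_torusHeatKernel (z i)

/-! ### The heat-kernel representation of the torus Green function -/

/-- `p_0 = 0` (private copy of `latticeMomentum_zero` of `GreenBlockSum.lean`, which is not in the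
import closure). [folklore] -/
private theorem latticeMomentum_zero' (L : ℕ) : latticeMomentum L (0 : TorusSite d L) = 0 := by
  funext i; simp [latticeMomentum]

/-- `ε(0) = 0` (private copy of `dispersion_zero` of `GreenBlockSum.lean`). [folklore] -/
private theorem dispersion_zero' : dispersion (0 : Fin d → ℝ) = 0 := by
  simp [dispersion]

/-- `ε(p_k) > 0` for `k ≠ 0`. [folklore] -/
theorem dispersion_latticeMomentum_pos {k : TorusSite d L} (hk : k ≠ 0) :
    0 < dispersion (latticeMomentum L k) :=
  lt_of_le_of_ne (dispersion_nonneg _) fun h =>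
    hk ((dispersion_latticeMomentum_eq_zero_iff_holds (d := d) (L := L) k).1 h.symm)

/-- `∫₀^S e^{-sε} ds = (1 - e^{-Sε})/ε` for `ε ≠ 0`. [folklore] -/
theorem integral_exp_neg_mul_eq {ε : ℝ} (hε : ε ≠ 0) (S : ℝ) :
    ∫ s in (0 : ℝ)..S, Real.exp (-(s * ε)) = (1 - Real.exp (-(S * ε))) / ε := by
  have h := intervalIntegral.integral_comp_mul_left (a := 0) (b := S) Real.exp (neg_ne_zero.2 hε)
  simp only [mul_zero, integral_exp, Real.exp_zero, smul_eq_mul] at h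
  have e : ∀ s : ℝ, -(s * ε) = -ε * s := fun s => by ring
  simp_rw [e]
  rw [h]
  field_simp
  ring

/-- **Heat-kernel representation of the torus Green function with a tail**: for every `S ≥ 0`,
`torusGreen z = ∫₀^S (∏ᵢ q^L_s(zᵢ) - L^{-d}) ds + L^{-d} ∑_{k ≠ 0} cos(p_k·z) e^{-Sε(p_k)}/ε(p_k)`.
Mode by mode this is `1/ε = ∫₀^S e^{-sε} ds + e^{-Sε}/ε` (`ε = ε(p_k) > 0` for `k ≠ 0`); the
`k = 0` mode of the heat kernel is the constant `L^{-d}`. (The Green function as the time integral of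
the transition kernel: Lawler–Limic 2010, Ch. 4.) [folklore] -/
theorem torusGreen_eq_integral_add_tail (z : TorusSite d L) (S : ℝ) :
    torusGreen z = (∫ s in (0 : ℝ)..S, (∏ i, torusHeatKernel s (z i) - ((L : ℝ) ^ d)⁻¹)) +
      (∑ k ∈ (univ : Finset (TorusSite d L)).erase 0,
        Real.cos (∑ i, latticeMomentum L k i * ((z i).val : ℝ)) *
          (Real.exp (-(S * dispersion (latticeMomentum L k))) /
            dispersion (latticeMomentum L k))) / (L : ℝ) ^ d := by
  classical
  have hLd : (0 : ℝ) < (L : ℝ) ^ d := by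
    have : (0 : ℝ) < L := by exact_mod_cast Nat.pos_of_ne_zero (NeZero.ne L)
    positivity
  -- the integrand, mode by mode
  have hP : ∀ s : ℝ, ∏ i, torusHeatKernel s (z i) - ((L : ℝ) ^ d)⁻¹ =
      (∑ k ∈ (univ : Finset (TorusSite d L)).erase 0,
        Real.cos (∑ i, latticeMomentum L k i * ((z i).val : ℝ)) *
          Real.exp (-(s * dispersion (latticeMomentum L k)))) / (L : ℝ) ^ d := by
    intro s
    rw [prod_torusHeatKernel_eq_sum, ← Finset.sum_erase_add _ _ (Finset.mem_univ (0 : TorusSite d L)),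
      latticeMomentum_zero', dispersion_zero']
    simp only [Pi.zero_apply, zero_mul, Finset.sum_const_zero, Real.cos_zero, mul_zero, neg_zero,
      Real.exp_zero, mul_one]
    field_simp
    ring
  simp_rw [hP]
  rw [intervalIntegral.integral_div, intervalIntegral.integral_finsetSum (fun k _ =>
    (Continuous.intervalIntegrable (by fun_prop) _ _)), ← add_div, ← Finset.sum_add_distrib]
  unfold torusGreen
  congr 1
  refine Finset.sum_congr rfl fun k hk => ?_
  have hk0 : k ≠ 0 := Finset.ne_of_mem_erase hk
  have hεk : dispersion (latticeMomentum L k) ≠ 0 := (dispersion_latticeMomentum_pos hk0).ne'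
  rw [intervalIntegral.integral_const_mul, integral_exp_neg_mul_eq hεk]
  field_simp
  ring

/-! ### The Hessian: heat-kernel part and Fourier tail -/

/-- `χ_k(eᵢ) = e(kᵢ)`. [folklore] -/
theorem torusChar_single_eq_stdAddChar (k : TorusSite d L) (i : Fin d) :
    torusChar k (Pi.single i 1) = (stdAddChar (k i) : ℂ) := by
  classical
  unfold torusChar
  rw [Finset.prod_eq_single i (fun j _ hj => by simp [Pi.single_eq_of_ne hj]) (fun h => absurd
    (Finset.mem_univ i) h)]
  simp

/-- **The Hessian of the torus Green function, heat-kernel part plus Fourier tail**: for every `S`,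
`∇ᵢ⁺∇ⱼ⁻ torusGreen (z) = ∫₀^S ∇ᵢ⁺∇ⱼ⁻[∏_μ q^L_s(·_μ)](z) ds
  + L^{-d} ∑_{k ≠ 0} (e^{-Sε_k}/ε_k) Re[χ_k(z)(χ_k(eᵢ) - 1)(1 - conj χ_k(eⱼ))]`,
where `∇ᵢ⁺∇ⱼ⁻F(z) = F(z+eᵢ) - F(z+eᵢ-eⱼ) - F(z) + F(z-eⱼ)` (the constant `L^{-d}` drops out of the
difference, and `cos(p_k·y) = Re χ_k(y)` with `χ_k(z ± e) = χ_k(z) χ_k(e)^{±1}`). [folklore] -/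
theorem torusGreen_hessian_eq (z : TorusSite d L) (i j : Fin d) (S : ℝ) :
    torusGreen (z + Pi.single i 1) - torusGreen (z + Pi.single i 1 - Pi.single j 1) -
        torusGreen z + torusGreen (z - Pi.single j 1) =
      (∫ s in (0 : ℝ)..S,
        ((∏ μ, torusHeatKernel s ((z + Pi.single i 1 : TorusSite d L) μ)) -
          (∏ μ, torusHeatKernel s ((z + Pi.single i 1 - Pi.single j 1 : TorusSite d L) μ)) -
          (∏ μ, torusHeatKernel s (z μ)) + ∏ μ, torusHeatKernel s ((z - Pi.single j 1 : TorusSite d L) μ))) +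
      (∑ k ∈ (univ : Finset (TorusSite d L)).erase 0,
        Real.exp (-(S * dispersion (latticeMomentum L k))) / dispersion (latticeMomentum L k) *
          (torusChar k z * (torusChar k (Pi.single i 1) - 1) *
            (1 - conj (torusChar k (Pi.single j 1)))).re) / (L : ℝ) ^ d := by
  have hI : ∀ y : TorusSite d L, IntervalIntegrable
      (fun s : ℝ => ∏ μ, torusHeatKernel s (y μ) - ((L : ℝ) ^ d)⁻¹) volume 0 S := fun y =>
    ((continuous_prod_torusHeatKernel y).sub continuous_const).intervalIntegrable _ _
  rw [torusGreen_eq_integral_add_tail (z + Pi.single i 1) S,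
    torusGreen_eq_integral_add_tail (z + Pi.single i 1 - Pi.single j 1) S,
    torusGreen_eq_integral_add_tail z S, torusGreen_eq_integral_add_tail (z - Pi.single j 1) S]
  have hint : (∫ s in (0 : ℝ)..S,
        ((∏ μ, torusHeatKernel s ((z + Pi.single i 1 : TorusSite d L) μ)) -
          (∏ μ, torusHeatKernel s ((z + Pi.single i 1 - Pi.single j 1 : TorusSite d L) μ)) -
          (∏ μ, torusHeatKernel s (z μ)) + ∏ μ, torusHeatKernel s ((z - Pi.single j 1 : TorusSite d L) μ))) =
      (∫ s in (0 : ℝ)..S, (∏ μ, torusHeatKernel s ((z + Pi.single i 1 : TorusSite d L) μ) - ((L : ℝ) ^ d)⁻¹)) -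
      (∫ s in (0 : ℝ)..S, (∏ μ, torusHeatKernel s ((z + Pi.single i 1 - Pi.single j 1 : TorusSite d L) μ) -
        ((L : ℝ) ^ d)⁻¹)) -
      (∫ s in (0 : ℝ)..S, (∏ μ, torusHeatKernel s (z μ) - ((L : ℝ) ^ d)⁻¹)) +
      (∫ s in (0 : ℝ)..S, (∏ μ, torusHeatKernel s ((z - Pi.single j 1 : TorusSite d L) μ) - ((L : ℝ) ^ d)⁻¹)) := by
    rw [← intervalIntegral.integral_sub (hI _) (hI _), ← intervalIntegral.integral_sub
      ((hI _).sub (hI _)) (hI _), ← intervalIntegral.integral_add (((hI _).sub (hI _)).sub (hI _))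
      (hI _)]
    congr 1
    funext s
    ring
  rw [hint]
  -- the tails
  have htail : ∀ k : TorusSite d L,
      Real.cos (∑ μ, latticeMomentum L k μ * (((z + Pi.single i 1 : TorusSite d L) μ).val : ℝ)) *
          (Real.exp (-(S * dispersion (latticeMomentum L k))) / dispersion (latticeMomentum L k)) -
        Real.cos (∑ μ, latticeMomentum L k μ * (((z + Pi.single i 1 - Pi.single j 1 : TorusSite d L) μ).val : ℝ)) *
          (Real.exp (-(S * dispersion (latticeMomentum L k))) / dispersion (latticeMomentum L k)) -
        Real.cos (∑ μ, latticeMomentum L k μ * ((z μ).val : ℝ)) *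
          (Real.exp (-(S * dispersion (latticeMomentum L k))) / dispersion (latticeMomentum L k)) +
        Real.cos (∑ μ, latticeMomentum L k μ * (((z - Pi.single j 1 : TorusSite d L) μ).val : ℝ)) *
          (Real.exp (-(S * dispersion (latticeMomentum L k))) / dispersion (latticeMomentum L k)) =
      Real.exp (-(S * dispersion (latticeMomentum L k))) / dispersion (latticeMomentum L k) *
        (torusChar k z * (torusChar k (Pi.single i 1) - 1) *
          (1 - conj (torusChar k (Pi.single j 1)))).re := by
    intro k
    rw [← torusChar_re, ← torusChar_re, ← torusChar_re, ← torusChar_re, torusChar_sub_right,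
      torusChar_add_right, torusChar_sub_right]
    simp only [Complex.sub_re, Complex.mul_re, Complex.one_re, Complex.one_im,
      Complex.conj_re, Complex.conj_im, Complex.sub_im, Complex.mul_im]
    ring
  rw [← Finset.sum_congr rfl fun k _ => htail k, Finset.sum_add_distrib, Finset.sum_sub_distrib,
    Finset.sum_sub_distrib]
  ring

/-! ### The Fourier tail is `O(L^{-d})` at `S = L²` -/

/-- `‖e(κ) - 1‖ ≤ |2π κ̃/L|` with the centred representative `κ̃ = valMinAbs κ`. [folklore] -/
theorem norm_stdAddChar_sub_one_le (κ : ZMod L) :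
    ‖(stdAddChar κ : ℂ) - 1‖ ≤ |2 * π * (κ.valMinAbs : ℝ) / L| := by
  have h : (stdAddChar κ : ℂ) = Complex.exp (Complex.I * (2 * π * (κ.valMinAbs : ℝ) / L : ℝ)) := by
    conv_lhs => rw [← ZMod.coe_valMinAbs κ]
    rw [ZMod.stdAddChar_coe]
    congr 1
    push_cast
    ring
  rw [h]
  exact Real.norm_exp_I_mul_ofReal_sub_one_le.trans (le_of_eq (Real.norm_eq_abs _))

/-- The centred momentum `p̃_k = 2πk̃/L` lies in the Brillouin zone `[-π, π]^d`. [folklore] -/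
theorem centredMomentum_mem_brillouin (k : TorusSite d L) :
    (fun μ => 2 * π * ((k μ).valMinAbs : ℝ) / L) ∈ brillouin d := by
  intro μ _
  have hL : (0 : ℝ) < L := by exact_mod_cast Nat.pos_of_ne_zero (NeZero.ne L)
  have h2 : 2 * |((k μ).valMinAbs : ℝ)| ≤ L := by
    have := two_mul_abs_valMinAbs_le (k μ)
    rw [← Int.cast_abs]; exact_mod_cast this
  rw [Set.mem_Icc, ← abs_le, abs_div, abs_mul, abs_mul, abs_two, abs_of_pos Real.pi_pos,
    Nat.abs_cast, div_le_iff₀ hL]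
  nlinarith [Real.pi_pos]

/-- The dispersion at the lattice momentum equals the dispersion at the centred momentum:
`ε(p_k) = ε(p̃_k)` (`p_k,μ - p̃_k,μ ∈ {0, 2π}`). [folklore] -/
theorem dispersion_latticeMomentum_eq_centred (k : TorusSite d L) :
    dispersion (latticeMomentum L k) = dispersion (fun μ => 2 * π * ((k μ).valMinAbs : ℝ) / L) := by
  have hL : (L : ℝ) ≠ 0 := by exact_mod_cast NeZero.ne L
  unfold dispersion
  refine Finset.sum_congr rfl fun μ _ => ?_
  congr 1
  simp only [latticeMomentum]
  have hv : (((k μ).val : ℤ) : ℝ) = ((k μ).valMinAbs : ℝ) +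
      ((if (k μ).val ≤ L / 2 then 0 else (L : ℤ) : ℤ) : ℝ) := by
    exact_mod_cast congrArg (fun x : ℤ => (x : ℝ)) (ZMod.val_eq_ite_valMinAbs (k μ))
  rw [show ((k μ).val : ℝ) = (((k μ).val : ℤ) : ℝ) by push_cast; rfl, hv]
  split_ifs
  · simp
  · push_cast
    rw [show 2 * π * (((k μ).valMinAbs : ℝ) + L) / L = 2 * π * ((k μ).valMinAbs : ℝ) / L + 2 * π by
      field_simp]
    exact Real.cos_add_two_pi _

/-- **The multiplier of the Hessian is dominated by the dispersion**:
`‖χ_k(eᵢ) - 1‖ ‖χ_k(eⱼ) - 1‖ ≤ (π²/2) ε(p_k)` (both factors are `≤ ‖p̃_k‖_∞`, and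
`ε ≥ (2/π²)‖p̃‖²_∞` on the Brillouin zone, `mul_norm_sq_le_dispersion`). [folklore] -/
theorem norm_torusChar_single_sub_one_mul_le (k : TorusSite d L) (i j : Fin d) :
    ‖torusChar k (Pi.single i 1) - 1‖ * ‖torusChar k (Pi.single j 1) - 1‖ ≤
      π ^ 2 / 2 * dispersion (latticeMomentum L k) := by
  set p : Fin d → ℝ := fun μ => 2 * π * ((k μ).valMinAbs : ℝ) / L with hp
  have hi : ‖torusChar k (Pi.single i 1) - 1‖ ≤ ‖p‖ := by
    rw [torusChar_single_eq_stdAddChar]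
    exact (norm_stdAddChar_sub_one_le (k i)).trans
      (le_of_eq_of_le (Real.norm_eq_abs _).symm (norm_le_pi_norm p i))
  have hj : ‖torusChar k (Pi.single j 1) - 1‖ ≤ ‖p‖ := by
    rw [torusChar_single_eq_stdAddChar]
    exact (norm_stdAddChar_sub_one_le (k j)).trans
      (le_of_eq_of_le (Real.norm_eq_abs _).symm (norm_le_pi_norm p j))
  have hε := mul_norm_sq_le_dispersion (centredMomentum_mem_brillouin k)
  rw [dispersion_latticeMomentum_eq_centred]
  have hπ : (0 : ℝ) < π ^ 2 := by positivity
  calc ‖torusChar k (Pi.single i 1) - 1‖ * ‖torusChar k (Pi.single j 1) - 1‖ ≤ ‖p‖ * ‖p‖ :=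
        mul_le_mul hi hj (norm_nonneg _) (norm_nonneg _)
    _ = π ^ 2 / 2 * (2 / π ^ 2 * ‖p‖ ^ 2) := by field_simp
    _ ≤ π ^ 2 / 2 * dispersion p := by gcongr

/-- `e^{-L² ε(p_k)} ≤ ∏_μ e^{-8 k̃_μ²}` (Jordan: `1 - cos p̃_μ ≥ (2/π²) p̃_μ² = 8k̃_μ²/L²`). [folklore] -/
theorem exp_neg_sq_mul_dispersion_le (k : TorusSite d L) :
    Real.exp (-((L : ℝ) ^ 2 * dispersion (latticeMomentum L k))) ≤
      ∏ μ, Real.exp (-(8 * ((k μ).valMinAbs : ℝ) ^ 2)) := by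
  have hL : (0 : ℝ) < L := by exact_mod_cast Nat.pos_of_ne_zero (NeZero.ne L)
  rw [← Real.exp_sum, Real.exp_le_exp, dispersion_latticeMomentum_eq_centred, dispersion,
    Finset.mul_sum, ← Finset.sum_neg_distrib]
  refine Finset.sum_le_sum fun μ _ => ?_
  have hmem := centredMomentum_mem_brillouin k μ (Set.mem_univ μ)
  have hJ := Real.cos_le_one_sub_mul_cos_sq (abs_le.2 hmem)
  rw [neg_le_neg_iff]
  have e : (L : ℝ) ^ 2 * (2 / π ^ 2 * (2 * π * ((k μ).valMinAbs : ℝ) / L) ^ 2) =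
      8 * ((k μ).valMinAbs : ℝ) ^ 2 := by
    field_simp
    ring
  rw [← e]
  exact mul_le_mul_of_nonneg_left (by linarith) (by positivity)

/-- `e^{-8n²} ≤ 2^{-|n|}` on `ℤ`. [folklore] -/
theorem exp_neg_eight_mul_sq_le (n : ℤ) :
    Real.exp (-(8 * (n : ℝ) ^ 2)) ≤ (1 / 2 : ℝ) ^ n.natAbs := by
  have hN : ((n.natAbs : ℕ) : ℝ) = |(n : ℝ)| := by
    rw [← Int.cast_abs, ← Int.natCast_natAbs]; rfl
  have h1 : Real.exp (-(8 * (n : ℝ) ^ 2)) ≤ Real.exp (-(n.natAbs : ℝ)) := by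
    rw [Real.exp_le_exp, neg_le_neg_iff, hN]
    have ha : |(n : ℝ)| ^ 2 = (n : ℝ) ^ 2 := sq_abs _
    have hint : |(n : ℝ)| ≤ (n : ℝ) ^ 2 := by
      rw [← Int.cast_abs]
      have : |n| ≤ |n| ^ 2 := by
        rcases eq_or_ne n 0 with rfl | hn
        · simp
        · nlinarith [Int.one_le_abs hn]
      have h2 : ((|n| : ℤ) : ℝ) ≤ (((|n| ^ 2 : ℤ)) : ℝ) := by exact_mod_cast this
      simpa [Int.cast_pow, Int.cast_abs, sq_abs] using h2
    nlinarith [abs_nonneg (n : ℝ)]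
  refine h1.trans ?_
  rw [show -(n.natAbs : ℝ) = (n.natAbs : ℝ) * (-1) by ring, Real.exp_nat_mul]
  apply pow_le_pow_left₀ (Real.exp_pos _).le
  have h2 : (1 : ℝ) + 1 ≤ Real.exp 1 := Real.add_one_le_exp 1
  rw [Real.exp_neg, inv_le_comm₀ (Real.exp_pos _) (by norm_num)]
  norm_num
  linarith

/-- `∑_{n ∈ ℤ} 2^{-|n|} < ∞`. [folklore] -/
theorem summable_half_pow_natAbs : Summable fun n : ℤ => (1 / 2 : ℝ) ^ n.natAbs := by
  refine Summable.of_nat_of_neg_add_one ?_ ?_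
  · simpa using summable_geometric_two
  · have : (fun n : ℕ => (1 / 2 : ℝ) ^ (-((n : ℤ) + 1)).natAbs) = fun n => 1 / 2 * (1 / 2) ^ n := by
      funext n
      rw [Int.natAbs_neg, show ((n : ℤ) + 1) = ((n + 1 : ℕ) : ℤ) by push_cast; rfl,
        Int.natAbs_natCast, pow_succ, mul_comm]
    rw [this]
    exact summable_geometric_two.mul_left _

/-- The sum of `2^{-|κ̃|}` over `ℤ/Lℤ` is bounded by the full sum over `ℤ`. [folklore] -/
theorem sum_half_pow_valMinAbs_le :
    ∑ κ : ZMod L, (1 / 2 : ℝ) ^ κ.valMinAbs.natAbs ≤ ∑' n : ℤ, (1 / 2 : ℝ) ^ n.natAbs := by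
  classical
  rw [← Finset.sum_image (f := fun n : ℤ => (1 / 2 : ℝ) ^ n.natAbs)
    (fun a _ b _ h => ZMod.injective_valMinAbs h)]
  exact summable_half_pow_natAbs.sum_le_tsum _ (fun n _ => by positivity)

/-- **The Fourier tail of the Hessian is `O(L^{-d})`**: with `C₀ = ∑_{n ∈ ℤ} 2^{-|n|}`, for all
`z, i, j`, `|L^{-d} ∑_{k≠0} (e^{-L²ε_k}/ε_k) Re[χ_k(z)(χ_k(eᵢ)-1)(1-conj χ_k(eⱼ))]| ≤ (π²/2) C₀^d L^{-d}`.
The multiplier bound `(π²/2)ε_k` cancels the divisor, and `∑_k e^{-L²ε_k} ≤ ∑_k ∏_μ 2^{-|k̃_μ|} =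
(∑_κ 2^{-|κ̃|})^d ≤ C₀^d`. [folklore] -/
theorem abs_torusGreen_hessian_tail_le (z : TorusSite d L) (i j : Fin d) :
    |(∑ k ∈ (univ : Finset (TorusSite d L)).erase 0,
        Real.exp (-((L : ℝ) ^ 2 * dispersion (latticeMomentum L k))) /
            dispersion (latticeMomentum L k) *
          (torusChar k z * (torusChar k (Pi.single i 1) - 1) *
            (1 - conj (torusChar k (Pi.single j 1)))).re) / (L : ℝ) ^ d| ≤
      π ^ 2 / 2 * (∑' n : ℤ, (1 / 2 : ℝ) ^ n.natAbs) ^ d / (L : ℝ) ^ d := by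
  classical
  have hLd : (0 : ℝ) < (L : ℝ) ^ d := by
    have : (0 : ℝ) < L := by exact_mod_cast Nat.pos_of_ne_zero (NeZero.ne L)
    positivity
  rw [abs_div, abs_of_pos hLd, div_le_div_iff_of_pos_right hLd]
  -- termwise bound
  have hterm : ∀ k ∈ (univ : Finset (TorusSite d L)).erase 0,
      |Real.exp (-((L : ℝ) ^ 2 * dispersion (latticeMomentum L k))) /
            dispersion (latticeMomentum L k) *
          (torusChar k z * (torusChar k (Pi.single i 1) - 1) *
            (1 - conj (torusChar k (Pi.single j 1)))).re| ≤
        π ^ 2 / 2 * ∏ μ, (1 / 2 : ℝ) ^ (k μ).valMinAbs.natAbs := by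
    intro k hk
    have hk0 : k ≠ 0 := Finset.ne_of_mem_erase hk
    have hε := dispersion_latticeMomentum_pos hk0
    rw [abs_mul, abs_div, Real.abs_exp, abs_of_pos hε]
    have hre : |(torusChar k z * (torusChar k (Pi.single i 1) - 1) *
        (1 - conj (torusChar k (Pi.single j 1)))).re| ≤
        π ^ 2 / 2 * dispersion (latticeMomentum L k) := by
      refine (Complex.abs_re_le_norm _).trans ?_
      rw [norm_mul, norm_mul, norm_torusChar, one_mul, ← norm_neg (1 - conj (torusChar k (Pi.single j 1))),
        neg_sub, ← Complex.norm_conj (conj (torusChar k (Pi.single j 1)) - 1), map_sub, map_one,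
        Complex.conj_conj]
      exact norm_torusChar_single_sub_one_mul_le k i j
    have hexp : Real.exp (-((L : ℝ) ^ 2 * dispersion (latticeMomentum L k))) ≤
        ∏ μ, (1 / 2 : ℝ) ^ (k μ).valMinAbs.natAbs :=
      (exp_neg_sq_mul_dispersion_le k).trans (Finset.prod_le_prod (fun μ _ => (Real.exp_pos _).le)
        fun μ _ => exp_neg_eight_mul_sq_le _)
    calc Real.exp (-((L : ℝ) ^ 2 * dispersion (latticeMomentum L k))) /
            dispersion (latticeMomentum L k) *
          |(torusChar k z * (torusChar k (Pi.single i 1) - 1) *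
            (1 - conj (torusChar k (Pi.single j 1)))).re|
        ≤ Real.exp (-((L : ℝ) ^ 2 * dispersion (latticeMomentum L k))) /
            dispersion (latticeMomentum L k) * (π ^ 2 / 2 * dispersion (latticeMomentum L k)) := by
          gcongr
      _ = π ^ 2 / 2 * Real.exp (-((L : ℝ) ^ 2 * dispersion (latticeMomentum L k))) := by
          field_simp
      _ ≤ π ^ 2 / 2 * ∏ μ, (1 / 2 : ℝ) ^ (k μ).valMinAbs.natAbs := by gcongr
  calc |∑ k ∈ (univ : Finset (TorusSite d L)).erase 0,
        Real.exp (-((L : ℝ) ^ 2 * dispersion (latticeMomentum L k))) /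
            dispersion (latticeMomentum L k) *
          (torusChar k z * (torusChar k (Pi.single i 1) - 1) *
            (1 - conj (torusChar k (Pi.single j 1)))).re|
      ≤ ∑ k ∈ (univ : Finset (TorusSite d L)).erase 0,
          π ^ 2 / 2 * ∏ μ, (1 / 2 : ℝ) ^ (k μ).valMinAbs.natAbs :=
        (Finset.abs_sum_le_sum_abs _ _).trans (Finset.sum_le_sum hterm)
    _ ≤ ∑ k : TorusSite d L, π ^ 2 / 2 * ∏ μ, (1 / 2 : ℝ) ^ (k μ).valMinAbs.natAbs :=
        Finset.sum_le_sum_of_subset_of_nonneg (Finset.erase_subset _ _) fun _ _ _ => by positivity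
    _ = π ^ 2 / 2 * (∑ κ : ZMod L, (1 / 2 : ℝ) ^ κ.valMinAbs.natAbs) ^ d := by
        rw [← Finset.mul_sum]
        congr 1
        rw [show (∑ κ : ZMod L, (1 / 2 : ℝ) ^ κ.valMinAbs.natAbs) ^ d =
            ∏ _μ : Fin d, ∑ κ : ZMod L, (1 / 2 : ℝ) ^ κ.valMinAbs.natAbs by
          rw [Finset.prod_const, Finset.card_univ, Fintype.card_fin],
          Finset.prod_univ_sum]
        simp only [Fintype.piFinset_univ]
    _ ≤ π ^ 2 / 2 * (∑' n : ℤ, (1 / 2 : ℝ) ^ n.natAbs) ^ d := by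
        gcongr
        exact sum_half_pow_valMinAbs_le

end Literature.Probability.LatticeModels
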